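/-
Copyright (c) 2026. All rights reserved.
Released under Apache 2.0 license as described in the file LICENSE.
Authors: abc-iut cell, prover seat abc-iut-f-066 (gen 8; row «F3081 BUILD r1» B2c, abc-iut-L4-lead m211/m212), over this
seat's B1/B2a/B2b (`LogFrobeniusRealisesRelLiftsTS{,Over,Push}.lean`), abc-iut-f-102's THEOREM-B datum
(`LogFrobeniusRealisesRelLifts.lean`) and abc-iut-f-101's `RelLifts.union` (`DiagramRelativeFamiliesUnion.lean`) — every input
consumed BY NAME; nothing of those files is restated.
-/
import Literature.AnabelianGeometry.AbsoluteAnabelian.LogFrobeniusRealisesRelLiftsTSOver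
import Literature.AnabelianGeometry.AbsoluteAnabelian.LogFrobeniusRealisesRelLiftsTSPush
import HarnessLib

/-!
# [AbsTopIII] Cor 5.5 (iii) on `D•⊢`: the UNION of THEOREM B's relative-lift datum with the `TS`-datum (pivots cores, `𝒩⊞_v`, `𝒩_v`)

S. Mochizuki, *Topics in absolute anabelian geometry III: global reconstruction algorithms* [MochizukiAbsTopIII2015];
locators `p.N` = pages of the author's manuscript (`paper:url-5493eb38cbb7`), read on the page: Cor 5.5 (iii) p. 131 ("the
families of homotopies that constitute `S_log` and `S_log⊞` are compatible with one another as well as with the families of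
homotopies that constitute the core and telecore structures of (i), (ii)"), Def 3.5 (ii) p. 75, §0 p. 26.

DEFINITION file for F-3081 (`Cor55ObservablesCompatible`, abc-iut-L4-t3), brick B2c of this seat's line: abc-iut-f-101's
`RelLifts.union` of abc-iut-f-102's THEOREM-B datum `realisesRelLifts lamOver logOver hsq hpre hpost` (pivots the three cores and the
`𝒩⊞_v`; abc-iut-L4-t3's print-faithful over-data) with B1's `tsRelLifts Hts` (pivots the `𝒩_v`): the vertex sets are disjoint
(`pivot_disjoint`), the cross law `𝒩⊞_v → 𝒩_v` is B2b's `crossLaw_realises_ts` (the `TS`-families are observables containing the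
diagonal: `hobs`, `hrefl`), the cross law `𝒩_v → core` is `crossLaw_ts_realises` (relatedness at a core is automatic, the
homotopy part is B2a's `tsRelLifts_θ_cross_core`: the `TS`-homotopies lie over `Th•[Z]`, `hover`) — ★ `realisesRelLiftsTS`, whose
generated family `relFamily` contains abc-iut-f-102's `K₁` and every `S_log_v` (B3, next file).
HONEST LABEL: MODEL-LEVEL bookkeeping over OUR typed interface; refereed pre-IUT material; nothing here bears on [IUTchIII]
Cor. 3.12; no side taken; typed ≠ proved.
-/

set_option autoImplicit false

universe u

open CategoryTheory Quiver

namespace Literature.AnabelianGeometry.AbsoluteAnabelian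

namespace LogFrobeniusSetting

open DiagramOfCategories

variable {Vmod : Type u} {isArc : Vmod → Bool} (L : LogFrobeniusSetting Vmod isArc)

section Union

variable (hsq : ∀ v, L.IotaSquaresCommute v)
  (hpre : ∀ (v : Vmod) (ν₁ ν₂ : LogVertex (isArc v)) (ε : LogEdge (isArc v) ν₁ ν₂) (h₁ : ν₁.isPostLog = false)
    (h₂ : ν₂.isPostLog = false) (X₀ : L.X), (L.toE v).map ((L.forget v).map ((L.iota v ε).app X₀)) ≍
    ((L.lamOverData v ν₁ h₁).hom.app X₀ ≫ (L.lamOverData v ν₂ h₂).inv.app X₀))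
  (hpost : ∀ (v : Vmod) (ν₁ ν₂ : LogVertex (isArc v)) (ε : LogEdge (isArc v) ν₁ ν₂) (_ : ν₁.isPostLog = true)
    (h₂ : ν₂.isPostLog = false) (hsl : (LogVertex.spaceLink (isArc v)).isPostLog = false) (X₀ : L.X),
    (L.toE v).map ((L.forget v).map ((L.iota v ε).app X₀)) ≍
    ((L.lamOverData v _ hsl).hom.app (L.log.obj X₀) ≫ L.logOver.hom.app X₀ ≫ (L.lamOverData v ν₂ h₂).inv.app X₀))
  (Hts : ∀ v : Vmod, (L.logDiagramTS v).HomotopyFamily) (T : L.TSHomotopies)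
  (hobs : ∀ v, L.IsLogObservableTS T v (Hts v))
  (hrefl : ∀ (v : Vmod) {a' : (logShapeTS (isArc := isArc) v).Vertex} (p : Path a' (logShapeTS (isArc := isArc) v).obs),
    (Hts v).E p p)
  (hover : ∀ (v : Vmod) {a' : (logShapeTS (isArc := isArc) v).Vertex}
    {p q : Path a' (logShapeTS (isArc := isArc) v).obs} (h : (Hts v).E p q), (L.logTSOverE v).IsOver p q ((Hts v).η h))

/-- **The pivots of THEOREM B and the `TS`-pivots are disjoint** (a core vertex or an `𝒩⊞_v` is not an `𝒩_{v'}`).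
[cite: MochizukiAbsTopIII2015, Cor 5.5 p. 129] -/
theorem pivot_disjoint (w : DVertex Vmod isArc) :
    (L.realisesRelLifts L.lamOverData L.logOver hsq hpre hpost).W w → (L.tsRelLifts Hts).W w → False := by
  rintro hw ⟨v, rfl⟩
  exact hw

/-- **No arrow leads from an `𝒩_v` to an `𝒩⊞_{v'}`** (row 4 to row 3). [cite: MochizukiAbsTopIII2015, Cor 5.5 p. 129] -/
theorem isEmpty_path_nv_nplus (v v' : Vmod) : IsEmpty (Path (DVertex.nv v : DVertex Vmod isArc) (.nplus v')) :=
  ⟨fun t => absurd (DVertex.row_le_of_path t) (by simp [DVertex.row])⟩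

include hover in
/-- **The cross law `𝒩_v → core`** from B1's `TS`-datum to THEOREM B's datum: a `TS`-pair post-composed with a path into a pivot of
THEOREM B — necessarily a core vertex — is related there (a core relates ALL pairs), and the core homotopy is the whiskered
`TS`-homotopy (B2a, over-ness of the `TS`-homotopies). [cite: MochizukiAbsTopIII2015, Cor 5.5 (iii) p. 131] -/
theorem crossLaw_ts_realises :
    RelLifts.CrossLaw (L.tsRelLifts Hts) (L.realisesRelLifts L.lamOverData L.logOver hsq hpre hpost) where
  rel := by
    rintro a w w' P Q t ⟨v, rfl⟩ hw' h
    cases w' with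
    | e5 => trivial
    | an => trivial
    | e7 => trivial
    | nplus v' => exact ((isEmpty_path_nv_nplus (isArc := isArc) v v').false t).elim
    | _ => exact hw'.elim
  θ_heq := by
    rintro a w w' ⟨v, rfl⟩ hw' P Q t h h'
    have hwc : IsCoreVertex w' := by
      cases w' with
      | e5 => trivial
      | an => trivial
      | e7 => trivial
      | nplus v' => exact ((isEmpty_path_nv_nplus (isArc := isArc) v v').false t).elim
      | _ => exact hw'.elim
    rw [realisesRelLifts_θ, L.pivotθ_eq_coreLift L.lamOverData L.logOver hwc hw' h']
    exact L.tsRelLifts_θ_cross_core Hts v hover h hwc t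

include hobs hrefl hover in
/-- ★ **The relative-lift datum of F-3081** (abc-iut-f-101's `RelLifts.union`): THEOREM B's datum (cores, `𝒩⊞_v`) ∪ the `TS`-datum
(`𝒩_v`), glued by the two cross laws. Its generated family `relFamily` is the ONE family on `D•⊢` of Cor 5.5 (iii), last sentence.
[cite: MochizukiAbsTopIII2015, Cor 5.5 (iii) p. 131] -/
noncomputable def realisesRelLiftsTS : L.diagram.RelLifts :=
  RelLifts.union (L.pivot_disjoint hsq hpre hpost Hts)
    (L.crossLaw_realises_ts L.lamOverData L.logOver hsq hpre hpost Hts T hobs hrefl)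
    (L.crossLaw_ts_realises hsq hpre hpost Hts hover)

/-- unfolding lemma. [cite: MochizukiAbsTopIII2015, Cor 5.5 (iii) p. 131] -/
theorem realisesRelLiftsTS_eq :
    L.realisesRelLiftsTS hsq hpre hpost Hts T hobs hrefl hover =
      RelLifts.union (L.pivot_disjoint hsq hpre hpost Hts)
        (L.crossLaw_realises_ts L.lamOverData L.logOver hsq hpre hpost Hts T hobs hrefl)
        (L.crossLaw_ts_realises hsq hpre hpost Hts hover) :=
  rfl

/-- **THEOREM B's family is a sub-family of the union's family** (same homotopies; abc-iut-f-101's `relFamily_sub_union_left`).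
[cite: MochizukiAbsTopIII2015, Definition 3.5 (ii) p.75] -/
theorem relFamily_realises_sub {a b : DVertex Vmod isArc} (P Q : Path a b)
    (h : (relFamily (L.realisesRelLifts L.lamOverData L.logOver hsq hpre hpost)).E P Q) :
    ∃ h' : (relFamily (L.realisesRelLiftsTS hsq hpre hpost Hts T hobs hrefl hover)).E P Q,
      (relFamily (L.realisesRelLifts L.lamOverData L.logOver hsq hpre hpost)).η h =
        (relFamily (L.realisesRelLiftsTS hsq hpre hpost Hts T hobs hrefl hover)).η h' :=
  RelLifts.relFamily_sub_union_left _ _ _ P Q h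

/-- **Every boundary pair of `S_log_v`, read on `D•⊢`, is a boundary pair of the union's family with the SAME homotopy** (B1's
`tsRelLifts_rel_of_mem` + abc-iut-f-101's `relFamily_union_η_eq_θ_right`): the `CompatibleIn` clause of F-3081.
[cite: MochizukiAbsTopIII2015, Cor 5.5 (iii) p. 131] -/
theorem relFamily_ts_mem (v : Vmod) {a' : (logShapeTS (isArc := isArc) v).Vertex}
    {p q : Path a' (logShapeTS (isArc := isArc) v).obs} (mem : (Hts v).E p q) :
    ∃ h' : (relFamily (L.realisesRelLiftsTS hsq hpre hpost Hts T hobs hrefl hover)).E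
        ((embExt (InPortionThree (isArc := isArc) v) (.nv v)).mapPath p)
        ((embExt (InPortionThree (isArc := isArc) v) (.nv v)).mapPath q),
      HEq ((Hts v).η mem) ((relFamily (L.realisesRelLiftsTS hsq hpre hpost Hts T hobs hrefl hover)).η h') := by
  obtain ⟨h, hθ⟩ := L.tsRelLifts_rel_of_mem Hts v mem
  have hw : (L.realisesRelLiftsTS hsq hpre hpost Hts T hobs hrefl hover).W (.nv v) := Or.inr (L.tsRelLifts_W_nv Hts v)
  have hr : (L.realisesRelLiftsTS hsq hpre hpost Hts T hobs hrefl hover).Rel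
      ((embExt (InPortionThree (isArc := isArc) v) (.nv v)).mapPath p)
      ((embExt (InPortionThree (isArc := isArc) v) (.nv v)).mapPath q) := Or.inr ⟨L.tsRelLifts_W_nv Hts v, h⟩
  refine ⟨relE_of_rel _ hw hr, hθ.symm.trans (heq_of_eq ?_)⟩
  exact (RelLifts.relFamily_union_η_eq_θ_right (L.pivot_disjoint hsq hpre hpost Hts)
    (L.crossLaw_realises_ts L.lamOverData L.logOver hsq hpre hpost Hts T hobs hrefl)
    (L.crossLaw_ts_realises hsq hpre hpost Hts hover) (L.tsRelLifts_W_nv Hts v) h _).symm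

end Union

end LogFrobeniusSetting

end Literature.AnabelianGeometry.AbsoluteAnabelian
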